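import Summits.CriticalPhenomena.PercolationContinuityZ3.Theorems.PercNearOneGluingNoHeavyLowerTailSahiCombLower
import Summits.CriticalPhenomena.PercolationContinuityZ3.Theorems.PercNearOneGluingNoHeavyLowerTailSahiCombMeetAbsorbing
import Summits.CriticalPhenomena.PercolationContinuityZ3.Theorems.PercNearOneGluingNoHeavyLowerTailSahiCombCylinder

/-!
# The comb (tensor-Bernstein) hierarchy for Sahi's `E_k`, VIII: the all-order unconditional rows for DECREASING events
# (the percolation separations) — triplewise meet-absorbing families and families with at most two non-co-cylinder members

Support file of the one-cut programme (crux `NoHeavyLowerTail`, stmt-CriticalPhenomena-4575; cell `prim-masterthm`, seat P3; HIERARCHY.md §9).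
The one-cut rows are `E_n` of group SEPARATIONS, i.e. of decreasing events.  By the reflection `p ↦ 1 − p` / complementation of configurations
(`CombPos.reflect`, `sahiE_ind_eq_sahiE_ind_preimage_compl`) the two all-order unconditional rows of `…SahiCombMeetAbsorbing` and
`…SahiCombCylinder` transfer verbatim:
* `combPos_sahiE_ind_lower_of_triplewise` — a family of `n` DECREASING events among any three of which one contains the intersection of the
  other two (chains of separations, Δ-systems of decreasing events, …) has `E_n` comb-positive at multidegree `n`, every `n`;
* `combPos_sahiE_ind_lower_of_allButTwoCoCylinders` — a family of `n` decreasing events all but at most two of which are CO-CYLINDERS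
  `{ω | Disjoint ω S_j}` ("all coordinates of `S_j` closed", e.g. "the edges at a terminal are closed") has `E_n` comb-positive at multidegree
  `n`, every `n`.
Unconditional; axioms standard. [this work]
-/

noncomputable section

open scoped Classical

namespace Summit.CriticalPhenomena.PercolationContinuityZ3.Theorems

open Finset Function
open Literature.Combinatorics.Sahi2008
open Literature.Probability.LatticeModels (isUpperSet_preimage_compl isLowerSet_preimage_compl)
open Literature.Probability.Percolation.DecisionTree (ind ind_of_mem ind_of_not_mem ind_nonneg)
open SahiComb

variable {ι : Type} [Fintype ι]

omit [Fintype ι] in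
/-- Complementing configurations preserves triplewise meet absorption. [folklore] -/
theorem TriplewiseMeetAbsorbing.preimage_compl {n : ℕ} {D : Fin n → Set (Set ι)} (h : TriplewiseMeetAbsorbing D) :
    TriplewiseMeetAbsorbing (fun j => compl ⁻¹' D j) := by
  intro i j l hij hil hjl
  rcases h i j l hij hil hjl with h1 | h1 | h1
  · exact Or.inl fun ω hω => h1 hω
  · exact Or.inr (Or.inl fun ω hω => h1 hω)
  · exact Or.inr (Or.inr fun ω hω => h1 hω)

/-- **Triplewise meet-absorbing families of DECREASING events are comb-positive at every order** (unconditional, all `n`). [this work] -/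
theorem combPos_sahiE_ind_lower_of_triplewise {n : ℕ} (D : Fin n → Set (Set ι)) (hD : ∀ j, IsLowerSet (D j))
    (hT : TriplewiseMeetAbsorbing D) :
    CombPos (fun _ : ι => n) (fun p => sahiE (bernoulliWeight p) n (fun j => ind (D j))) := by
  have h1 := (combPos_sahiE_ind_of_triplewise n (fun j => compl ⁻¹' D j) (fun j => isUpperSet_preimage_compl (hD j))
    hT.preimage_compl).reflect
  exact h1.congr fun p => sahiE_ind_eq_sahiE_ind_preimage_compl p D

/-- Chains of decreasing events are comb-positive at every order. [this work] -/
theorem combPos_sahiE_ind_lower_of_chain {n : ℕ} (D : Fin n → Set (Set ι)) (hD : ∀ j, IsLowerSet (D j))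
    (h : ∀ i j : Fin n, D i ⊆ D j ∨ D j ⊆ D i) :
    CombPos (fun _ : ι => n) (fun p => sahiE (bernoulliWeight p) n (fun j => ind (D j))) :=
  combPos_sahiE_ind_lower_of_triplewise D hD (triplewiseMeetAbsorbing_of_chain h)

/-- **Families of decreasing events with at most two non-co-cylinder members are comb-positive at every order** (unconditional, all `n`):
if all `D_j`, `j ∉ E`, are co-cylinders `{ω | Disjoint ω S_j}` for some `|E| ≤ 2`, then `E_n(μ_p; 1_D)` has a nonnegative degree-`n`
tensor-Bernstein representation. [this work] -/
theorem combPos_sahiE_ind_lower_of_allButTwoCoCylinders {n : ℕ} (D : Fin n → Set (Set ι)) (hD : ∀ j, IsLowerSet (D j))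
    (hE : ∃ E : Finset (Fin n), E.card ≤ 2 ∧ ∀ j, j ∉ E → ∃ S : Set ι, D j = {ω : Set ι | Disjoint ω S}) :
    CombPos (fun _ : ι => n) (fun p => sahiE (bernoulliWeight p) n (fun j => ind (D j))) := by
  obtain ⟨E, hEcard, hco⟩ := hE
  have hE' : ∃ E : Finset (Fin n), E.card ≤ 2 ∧ ∀ j, j ∉ E → ∃ S : Set ι, compl ⁻¹' D j = {ω : Set ι | S ⊆ ω} := by
    refine ⟨E, hEcard, fun j hj => ?_⟩
    obtain ⟨S, hS⟩ := hco j hj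
    exact ⟨S, by rw [hS, preimage_compl_coCylinder]⟩
  have h1 := (combPos_sahiE_ind_of_allButTwoCylinders n (fun j => compl ⁻¹' D j) (fun j => isUpperSet_preimage_compl (hD j))
    hE').reflect
  exact h1.congr fun p => sahiE_ind_eq_sahiE_ind_preimage_compl p D

/-- Every family of co-cylinders ("all coordinates of `S_j` closed") is comb-positive at every order. [this work] -/
theorem combPos_sahiE_ind_of_coCylinders {n : ℕ} (S : Fin n → Set ι) :
    CombPos (fun _ : ι => n) (fun p => sahiE (bernoulliWeight p) n (fun j => ind {ω : Set ι | Disjoint ω (S j)})) :=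
  combPos_sahiE_ind_lower_of_allButTwoCoCylinders (fun j => {ω : Set ι | Disjoint ω (S j)})
    (fun j _ _ hle hω => Set.disjoint_of_subset_left hle hω) ⟨∅, by simp, fun j _ => ⟨S j, rfl⟩⟩

/-- Law-level shadow for decreasing events: `E_n(μ_p; 1_D) ≥ 0` for families with at most two non-co-cylinder members. [this work] -/
theorem sahiE_ind_lower_nonneg_of_allButTwoCoCylinders {n : ℕ} (p : ι → unitInterval) (D : Fin n → Set (Set ι))
    (hD : ∀ j, IsLowerSet (D j))
    (hE : ∃ E : Finset (Fin n), E.card ≤ 2 ∧ ∀ j, j ∉ E → ∃ S : Set ι, D j = {ω : Set ι | Disjoint ω S}) :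
    0 ≤ sahiE (bernoulliWeight p) n (fun j => ind (D j)) :=
  (combPos_sahiE_ind_lower_of_allButTwoCoCylinders D hD hE).nonneg p

end Summit.CriticalPhenomena.PercolationContinuityZ3.Theorems
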